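import Summits.Langlands.Langlands.Theses.IrreducibilityBySelfDuality
import Literature.NumberTheory.GaloisRepresentations.HeckeCharacterArchType

/-!
# Sketch — crux idea `torsion-blind-unit-criterion` (ideator 3, round 1)

Crux: `Summit.Langlands.Langlands.Theses.IrreducibilityBySelfDuality.HalfIntegralTwistCM`
(stmt-Langlands-14036). Nothing here restates or weakens the crux; these are the first checkable
statements of the line (blindness of Weil's unit product to angular exponents over a CM field,
the blind-and-halve transfer of Weil's hypothesis, and the classification transfer `C⁺`).
-/

set_option linter.dupNamespace false

namespace Summit.Langlands.Langlands.Cruxes.HalfIntegralTwistCM.IdeaSketch3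

open NumberField NumberField.Units NumberField.InfinitePlace NumberField.ComplexEmbedding
open Literature.NumberTheory.GaloisRepresentations
open Literature.NumberTheory.Automorphic
open scoped ComplexConjugate NumberField Classical

/-- The crux under attack, by name (definitionally the route decl). -/
abbrev Crux : Prop :=
  Summit.Langlands.Langlands.Theses.IrreducibilityBySelfDuality.HalfIntegralTwistCM

section Blindness

variable (K : Type*) [Field K] [NumberField K] [IsCMField K]

/-- CM TORSION (Kronecker, carried by Mathlib's `IsCMField.unitsMulComplexConjInv : (𝓞 K)ˣ →* torsion K`):
for a unit `α` of a CM field and ANY embedding `φ`, `φ α / conj (φ α) = φ (α ᾱ⁻¹)` is a root of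
unity of order dividing `w_K = torsionOrder K`. -/
theorem embedding_div_conj_pow_torsionOrder (φ : K →+* ℂ) (α : (𝓞 K)ˣ) :
    ((φ ((α : 𝓞 K) : K)) / conj (φ ((α : 𝓞 K) : K))) ^ torsionOrder K = 1 := by
  -- `ζ := α * (conj α)⁻¹ ∈ torsion K`, hence `ζ ^ torsionOrder K = 1`
  have hζmem : ((IsCMField.unitsMulComplexConjInv K α : torsion K) : (𝓞 K)ˣ) ∈
      rootsOfUnity (torsionOrder K) (𝓞 K) := by
    rw [rootsOfUnity_eq_torsion]; exact Subtype.coe_prop _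
  have hζ : (((IsCMField.unitsMulComplexConjInv K α : torsion K) : (𝓞 K)ˣ)) ^ torsionOrder K = 1 :=
    (mem_rootsOfUnity _ _).mp hζmem
  -- the conjugate unit, read in `ℂ` through `φ`
  have hconj : φ ((((IsCMField.unitsComplexConj K α : (𝓞 K)ˣ) : 𝓞 K) : K)) =
      conj (φ ((α : 𝓞 K) : K)) := by
    rw [← IsCMField.complexEmbedding_complexConj K φ]
    rfl
  -- the torsion unit, read in `ℂ` through `φ`
  have hval : ((Units.complexEmbedding φ
      ((IsCMField.unitsMulComplexConjInv K α : torsion K) : (𝓞 K)ˣ) : ℂˣ) : ℂ) =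
      φ ((α : 𝓞 K) : K) / conj (φ ((α : 𝓞 K) : K)) := by
    rw [IsCMField.unitsMulComplexConjInv_apply, map_mul, map_inv, Units.val_mul,
      Units.val_inv_eq_inv_val, Units.complexEmbedding_apply, Units.complexEmbedding_apply, hconj,
      div_eq_mul_inv]
  have h := congrArg (fun u : (𝓞 K)ˣ => ((Units.complexEmbedding φ u : ℂˣ) : ℂ)) hζ
  simp only [map_pow, map_one, Units.val_pow_eq_pow_val, Units.val_one] at h
  rwa [hval] at h

/-- BLINDNESS CORE: the angular part of a CM unit at any embedding is killed by `2 w_K`: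
`(φ α / |φ α|)^(2 w_K) = 1`, because `(z/|z|)² = z / conj z`. -/
theorem embedding_div_norm_pow_eq_one (φ : K →+* ℂ) (α : (𝓞 K)ˣ) :
    ((φ ((α : 𝓞 K) : K)) / (‖φ ((α : 𝓞 K) : K)‖ : ℂ)) ^ (2 * torsionOrder K) = 1 := by
  set z : ℂ := φ ((α : 𝓞 K) : K) with hz
  have hz0 : z ≠ 0 := by
    rw [hz, map_ne_zero]
    exact_mod_cast Units.ne_zero α
  have hsq : (z / (‖z‖ : ℂ)) ^ 2 = z / conj z := by
    have hn : (‖z‖ : ℂ) ≠ 0 := by exact_mod_cast (norm_ne_zero_iff.mpr hz0)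
    have hc : conj z ≠ 0 := (map_ne_zero _).mpr hz0
    have hnorm : ((‖z‖ : ℂ)) ^ 2 = z * conj z := by
      rw [Complex.mul_conj, Complex.normSq_eq_norm_sq]; push_cast; ring
    field_simp
    rw [hnorm]
    try ring
  rw [pow_mul, hsq]
  exact embedding_div_conj_pow_torsionOrder K φ α

/-- BLIND: on a CM unit Weil's local factor `(z/|z|)^m |z|^{it}` forgets `m` once raised to `2 w_K`. -/
theorem archUnitaryValue_unit_pow_blind (m : ℤ) (t : ℝ) (φ : K →+* ℂ) (α : (𝓞 K)ˣ) :
    archUnitaryValue m t (φ ((α : 𝓞 K) : K)) ^ (2 * torsionOrder K) =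
      archUnitaryValue 0 t (φ ((α : 𝓞 K) : K)) ^ (2 * torsionOrder K) := by
  unfold archUnitaryValue
  rw [mul_pow, mul_pow, zpow_zero, one_pow, one_mul, ← zpow_natCast (_ ^ m), ← zpow_mul, mul_comm m,
    zpow_mul, zpow_natCast, embedding_div_norm_pow_eq_one K φ α, one_zpow, one_mul]

end Blindness

/-- HALVE: the pure-modulus factor halves exactly on any complex number:
`(|z|^{i t/2})² = |z|^{i t}` (principal power of a non-negative real). -/
theorem archUnitaryValue_zero_half_sq (t : ℝ) (z : ℂ) :
    archUnitaryValue 0 (t / 2) z ^ 2 = archUnitaryValue 0 t z := by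
  unfold archUnitaryValue
  rw [zpow_zero, one_mul, one_mul, ← Complex.cpow_nat_mul]
  congr 1
  push_cast; ring

/-- **FIRST LEMMA of the line (blind-and-halve transfer of Weil's unit hypothesis over a CM field).**
If the unitary archimedean type `(m, t)` satisfies Weil's unit criterion (finite-index form, exactly the
right-hand side of the tree's named fact `Patrikis2019_heckeCharacter_archType_iff_units`), then so does
`(m', t/2)` for EVERY `m'`: the angular exponents are invisible on CM units (`2 w_K`-torsion) and the
modulus exponents halve on positive reals. No `K⁺`, no unit index, no squares of a congruence subgroup,
no Chevalley. -/
theorem weilHypothesis_blind_halve (K : Type*) [Field K] [NumberField K] [IsCMField K]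
    (m m' : InfinitePlace K → ℤ) (t : InfinitePlace K → ℝ)
    (h : ∃ M : ℕ, 0 < M ∧ ∀ α : (𝓞 K)ˣ,
      (∏ w : InfinitePlace K, archUnitaryValue (m w) (t w) (w.embedding ((α : 𝓞 K) : K))) ^ M = 1) :
    ∃ M' : ℕ, 0 < M' ∧ ∀ α : (𝓞 K)ˣ,
      (∏ w : InfinitePlace K,
        archUnitaryValue (m' w) (t w / 2) (w.embedding ((α : 𝓞 K) : K))) ^ M' = 1 := by
  obtain ⟨M, hM, hrel⟩ := h
  set n := torsionOrder K with hn
  refine ⟨2 * n * (2 * M), by have := torsionOrder_pos K; positivity, fun α => ?_⟩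
  -- blind at level `2n`, then halve, then blind back and use the hypothesis
  have key : ∀ (μ : InfinitePlace K → ℤ) (α : (𝓞 K)ˣ) (s : InfinitePlace K → ℝ),
      (∏ w : InfinitePlace K, archUnitaryValue (μ w) (s w) (w.embedding ((α : 𝓞 K) : K))) ^ (2 * n) =
        (∏ w : InfinitePlace K, archUnitaryValue 0 (s w) (w.embedding ((α : 𝓞 K) : K))) ^ (2 * n) := by
    intro μ α s
    rw [← Finset.prod_pow, ← Finset.prod_pow]
    exact Finset.prod_congr rfl fun w _ => archUnitaryValue_unit_pow_blind K (μ w) (s w) w.embedding α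
  calc (∏ w : InfinitePlace K, archUnitaryValue (m' w) (t w / 2) (w.embedding ((α : 𝓞 K) : K))) ^
          (2 * n * (2 * M))
      = ((∏ w : InfinitePlace K, archUnitaryValue 0 (t w / 2) (w.embedding ((α : 𝓞 K) : K))) ^
          (2 * n)) ^ (2 * M) := by rw [pow_mul, key]
    _ = ((∏ w : InfinitePlace K, archUnitaryValue 0 (t w / 2) (w.embedding ((α : 𝓞 K) : K))) ^ 2) ^
          (2 * n * M) := by rw [← pow_mul, ← pow_mul]; congr 1; ring
    _ = (∏ w : InfinitePlace K, archUnitaryValue 0 (t w) (w.embedding ((α : 𝓞 K) : K))) ^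
          (2 * n * M) := by
        rw [← Finset.prod_pow]
        congr 1
        exact Finset.prod_congr rfl fun w _ => archUnitaryValue_zero_half_sq (t w) _
    _ = ((∏ w : InfinitePlace K, archUnitaryValue 0 (t w) (w.embedding ((α : 𝓞 K) : K))) ^ (2 * n)) ^ M := by
        rw [← pow_mul]
    _ = ((∏ w : InfinitePlace K, archUnitaryValue (m w) (t w) (w.embedding ((α : 𝓞 K) : K))) ^ (2 * n)) ^ M := by
        rw [key m α t]
    _ = ((∏ w : InfinitePlace K, archUnitaryValue (m w) (t w) (w.embedding ((α : 𝓞 K) : K))) ^ M) ^ (2 * n) := by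
        rw [← pow_mul, ← pow_mul, mul_comm]
    _ = 1 := by rw [hrel α, one_pow]

/-- Inversion of Weil's local factor: `(m, t) ↦ (-m, -t)` inverts the value (for `z ≠ 0`). -/
theorem archUnitaryValue_neg_neg (m : ℤ) (t : ℝ) {z : ℂ} (hz : z ≠ 0) :
    archUnitaryValue (-m) (-t) z = (archUnitaryValue m t z)⁻¹ := by
  unfold archUnitaryValue
  rw [zpow_neg, mul_inv]
  congr 1
  rw [← Complex.cpow_neg]
  congr 1
  push_cast; ring

/-- The blind-and-halve transfer with the SIGN the crux needs (`t ↦ -t/2`: the half-twist carries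
`Im (p σ_w + p σ̄_w) = -Im (e σ_w + e σ̄_w)/2`). -/
theorem weilHypothesis_blind_halve_neg (K : Type*) [Field K] [NumberField K] [IsCMField K]
    (m m' : InfinitePlace K → ℤ) (t : InfinitePlace K → ℝ)
    (h : ∃ M : ℕ, 0 < M ∧ ∀ α : (𝓞 K)ˣ,
      (∏ w : InfinitePlace K, archUnitaryValue (m w) (t w) (w.embedding ((α : 𝓞 K) : K))) ^ M = 1) :
    ∃ M' : ℕ, 0 < M' ∧ ∀ α : (𝓞 K)ˣ,
      (∏ w : InfinitePlace K,
        archUnitaryValue (m' w) (-(t w) / 2) (w.embedding ((α : 𝓞 K) : K))) ^ M' = 1 := by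
  -- invert the hypothesis to the type `(-m, -t)`, then blind-and-halve
  have h' : ∃ M : ℕ, 0 < M ∧ ∀ α : (𝓞 K)ˣ,
      (∏ w : InfinitePlace K, archUnitaryValue (-m w) (-t w) (w.embedding ((α : 𝓞 K) : K))) ^ M = 1 := by
    obtain ⟨M, hM, hrel⟩ := h
    refine ⟨M, hM, fun α => ?_⟩
    have hz : ∀ w : InfinitePlace K, w.embedding ((α : 𝓞 K) : K) ≠ 0 := fun w => by
      rw [map_ne_zero]; exact_mod_cast Units.ne_zero α
    rw [Finset.prod_congr rfl fun w _ => archUnitaryValue_neg_neg (m w) (t w) (hz w),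
      Finset.prod_inv_distrib, inv_pow, hrel α, inv_one]
  simpa [neg_div] using weilHypothesis_blind_halve K (fun w => -m w) m' (fun w => -t w) h'

/-- `(e^x)^s = e^{x s}` for real `x` (principal power of a positive real). -/
theorem ofReal_exp_cpow (x : ℝ) (s : ℂ) : ((Real.exp x : ℝ) : ℂ) ^ s = Complex.exp (x * s) := by
  have hpos : (0 : ℝ) < Real.exp x := Real.exp_pos x
  have hne : ((Real.exp x : ℝ) : ℂ) ≠ 0 := by exact_mod_cast hpos.ne'
  rw [Complex.cpow_def_of_ne_zero hne, Complex.ofReal_exp,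
    Complex.log_exp (by simp [Real.pi_pos]) (by simpa using Real.pi_pos.le)]

/-- BRIDGE (values on `exp` in WEIL FORM): for `p - q = m ∈ ℤ`, the value `e^{a p + ā q}` of the
character `z^p z̄^q` at `z = e^a` is `|z|^{Re (p+q)} · (z/|z|)^m |z|^{i Im (p+q)}` — the modulus power
times Weil's unitary local factor. This is the glue between the Disproof's PROVED §2
(`archParam_complexPlace_glOne`: `χ_ω(det(exp a_w, 1)) = e^{a p + ā q}`) and the unit criterion. -/
theorem exp_linear_eq_norm_cpow_mul_archUnitaryValue (p q : ℂ) (m : ℤ) (hm : p - q = m) (a : ℂ) :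
    Complex.exp (a * p + conj a * q) =
      ((‖Complex.exp a‖ : ℂ) ^ (((p + q).re : ℝ) : ℂ)) *
        archUnitaryValue m ((p + q).im) (Complex.exp a) := by
  obtain ⟨x, y, rfl⟩ : ∃ x y : ℝ, a = x + y * Complex.I := ⟨a.re, a.im, (Complex.re_add_im a).symm⟩
  have hre : ((x : ℂ) + y * Complex.I).re = x := by simp
  have hnorm : ‖Complex.exp (x + y * Complex.I)‖ = Real.exp x := by rw [Complex.norm_exp, hre]
  have hratio : Complex.exp (x + y * Complex.I) / (‖Complex.exp (x + y * Complex.I)‖ : ℂ) =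
      Complex.exp (y * Complex.I) := by
    rw [hnorm, Complex.ofReal_exp, ← Complex.exp_sub]
    congr 1; ring
  have hq : q = p - m := by rw [← hm]; ring
  unfold archUnitaryValue
  rw [hratio, hnorm, ofReal_exp_cpow, ofReal_exp_cpow, ← Complex.exp_int_mul, ← Complex.exp_add,
    ← Complex.exp_add]
  congr 1
  simp only [map_add, map_mul, Complex.conj_ofReal, Complex.conj_I]
  rw [hq]
  have h2 := Complex.re_add_im (p + (p - m))
  linear_combination (-(x : ℂ)) * h2

/-- STUB 1 of the line (NECESSITY IN WEIL FORM, free — no named fact): for a cuspidal `GL(1)` datum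
`ω` over a CM field with archimedean parameter `ι ↦ {e ι}`, Weil's unit product for the unitary type
`(e σ_w − e σ̄_w, Im (e σ_w + e σ̄_w))` is killed by a uniform exponent `M` on ALL global units.
Proof line: `θ = χ_ω` has a level `𝔪` (`HeckeCharacter.exists_level_glOne`, proved), `u^M ≡ 1 (𝔪)`
for all units (`exists_unit_pow_sub_one_mem`, proved), `θ(principal idele) = 1`, so
`θ((u_∞^M, 1)) = 1`; read `θ((u_∞, 1))` through `archParam_complexPlace_glOne` (Disproof §2, proved) and
the bridge above; the modulus powers multiply to `|N u|^{Re} = 1` by `exists_re_archParam_parallel_glOne`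
(Disproof §4, proved). -/
theorem necessity_weilForm (K : Type) [Field K] [NumberField K] (hK : IsCMField K)
    (h1 : isCompact_glFiniteIntegralLevel 1 K) (ω : CuspidalAutomorphicRepData 1 K h1)
    (e : (K →+* ℂ) → ℂ) (hω : ω.1.HasArchParameter (fun ι => {e ι}))
    (me : InfinitePlace K → ℤ) (hme : ∀ w : InfinitePlace K,
      e w.embedding - e (conjugate w.embedding) = me w) :
    ∃ M : ℕ, 0 < M ∧ ∀ α : (𝓞 K)ˣ,
      (∏ w : InfinitePlace K, archUnitaryValue (me w) ((e w.embedding + e (conjugate w.embedding)).im)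
        (w.embedding ((α : 𝓞 K) : K))) ^ M = 1 := by
  sorry

/-- CONSEQUENCE through the named fact (the ⇐ direction is the ONLY place the line touches it; the ⇒
direction is used here for brevity but is free for the line's `θ = χ_ω`, see the card): over a CM field,
half the modulus-type of a unitary Hecke character, with ARBITRARY new angular exponents, is again the
type of a unitary Hecke character. -/
theorem exists_heckeCharacter_half_type (hW : Patrikis2019_heckeCharacter_archType_iff_units)
    (K : Type) [Field K] [NumberField K] [IsCMField K]
    (m m' : InfinitePlace K → ℤ) (t : InfinitePlace K → ℝ)
    (ψ : HeckeCharacter K) (hψu : ψ.IsUnitary) (hψ : ψ.HasUnitaryArchType m t) :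
    ∃ χ : HeckeCharacter K, χ.IsUnitary ∧ χ.HasUnitaryArchType m' (fun w => t w / 2) :=
  (hW K m' fun w => t w / 2).mpr
    (weilHypothesis_blind_halve K m m' t ((hW K m t).mp ⟨ψ, hψu, hψ⟩))

/-- TRANSFER `C⁺` (classification of the archimedean parameters of automorphic `GL(1)` data over a CM
field; the crux is the instance `e = s₁ + s₂`, `p = ½ − s₁ + N`): `ι ↦ {e ι}` is the archimedean
parameter of SOME cuspidal `GL(1)` datum iff (I) `e ι − e ῑ ∈ ℤ` (it is a character of `ℂˣ`), (R) the
real weight `Re (e ι + e ῑ)` is constant (it is `|·|^r` times unitary), and (T) the imaginary weights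
`Im (e σ_w + e σ̄_w)` satisfy a RATIONAL unit relation (Weil's criterion with the angular exponents
erased — blindness). No condition whatsoever on the integers `e ι − e ῑ`. -/
def AutomorphicArchParamCM : Prop :=
  ∀ (K : Type) [Field K] [NumberField K], IsCMField K →
    ∀ (h1 : isCompact_glFiniteIntegralLevel 1 K) (e : (K →+* ℂ) → ℂ),
      (∃ χ : CuspidalAutomorphicRepData 1 K h1, χ.1.HasArchParameter (fun ι => {e ι})) ↔
        ((∀ ι : K →+* ℂ, ∃ n : ℤ, e ι - e (conjugate ι) = n) ∧
          (∃ r : ℝ, ∀ ι : K →+* ℂ, (e ι + e (conjugate ι)).re = r) ∧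
          (∃ M : ℕ, 0 < M ∧ ∀ α : (𝓞 K)ˣ,
            (∏ w : InfinitePlace K,
              ((‖w.embedding ((α : 𝓞 K) : K)‖ : ℂ) ^
                ((((e w.embedding + e (conjugate w.embedding)).im : ℝ) : ℂ) * Complex.I))) ^ M = 1))

/-! ### Bookkeeping for the transfer: embeddings of a CM field come in conjugate pairs -/

section PairBookkeeping

variable {K : Type} [Field K] [NumberField K]

theorem conjugate_conjugate' (ι : K →+* ℂ) : conjugate (conjugate ι) = ι :=
  RingHom.ext fun x => by simp

theorem mk_embedding_cases (ι : K →+* ℂ) :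
    (InfinitePlace.mk ι).embedding = ι ∨ (InfinitePlace.mk ι).embedding = conjugate ι := by
  rcases InfinitePlace.mk_eq_iff.mp (InfinitePlace.mk_embedding (InfinitePlace.mk ι)) with h | h
  · exact Or.inl h
  · right
    have h' := congrArg conjugate h
    rw [conjugate_conjugate'] at h'
    exact h'

/-- Over a CM (hence totally complex) field no embedding is its own conjugate. -/
theorem conjugate_ne_self [IsCMField K] (ι : K →+* ℂ) : conjugate ι ≠ ι := by
  intro h
  have hreal : ComplexEmbedding.IsReal ι := ComplexEmbedding.isReal_iff.mpr h
  have h1 : (InfinitePlace.mk ι).IsReal := isReal_mk_iff.mpr hreal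
  have h2 : (InfinitePlace.mk ι).IsComplex := NumberField.IsTotallyComplex.isComplex _
  exact (not_isReal_iff_isComplex.mpr h2) h1

/-- The flattening integers: put the whole correction `j` on ONE embedding of each conjugate pair.
`N ι + N ῑ = j ι` whenever `j` is conjugation-symmetric. -/
theorem flatten_pair [IsCMField K] (j : (K →+* ℂ) → ℤ) (hj : ∀ ι, j (conjugate ι) = j ι) (ι : K →+* ℂ) :
    ((if (InfinitePlace.mk ι).embedding = ι then j ι else 0 : ℤ) : ℂ) +
      ((if (InfinitePlace.mk (conjugate ι)).embedding = conjugate ι then j (conjugate ι) else 0 : ℤ) : ℂ) =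
        j ι := by
  have hne := conjugate_ne_self ι
  rw [InfinitePlace.mk_conjugate_eq]
  rcases mk_embedding_cases ι with h | h
  · rw [if_pos h, if_neg (by rw [h]; exact hne.symm)]
    push_cast; ring
  · rw [if_neg (by rw [h]; exact hne), if_pos h, hj]
    push_cast; ring

end PairBookkeeping

/-- **The crux is the instance `e := s₁ + s₂ ↦ p := ½ − s₁ + N` of the classification `C⁺`**
(kernel-checked bookkeeping): (T) for `p` is (T) for `e` with the imaginary weights multiplied by `−½`,
(R) for `p` is (R) for `e`, (I) for `p` is hypothesis (ii), and (iii) supplies the flattening integers `N ι`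
(the whole correction `j ι = ((s₁−s₂) ι + (s₁−s₂) ῑ)/2` sits on one embedding of each pair). Hypothesis (i)
is not used (cf. Disproof F3(a)). -/
theorem crux_of_classification (hC : AutomorphicArchParamCM) : Crux := by
  intro K _ _ hK h1 s₁ s₂ _hi hii hiii hiv
  haveI : IsCMField K := hK
  -- the classification for `e = s₁ + s₂`
  set e : (K →+* ℂ) → ℂ := fun ι => s₁ ι + s₂ ι with he
  obtain ⟨-, ⟨r, hR⟩, ⟨M, hM, hT⟩⟩ := (hC K hK h1 e).mp hiv
  -- the flattening integers from (iii)
  choose j hj using hiii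
  have hj_symm : ∀ ι, j (conjugate ι) = j ι := by
    intro ι
    have h1' := hj ι
    have h2' := hj (conjugate ι)
    rw [conjugate_conjugate'] at h2'
    have : (2 : ℂ) * (j (conjugate ι) : ℂ) = 2 * (j ι : ℂ) := by rw [← h1', ← h2']; ring
    exact_mod_cast (mul_right_injective₀ (two_ne_zero' ℂ) this)
  set N : (K →+* ℂ) → ℤ := fun ι => if (InfinitePlace.mk ι).embedding = ι then j ι else 0 with hN
  have hNpair : ∀ ι, (N ι : ℂ) + N (conjugate ι) = j ι := fun ι => flatten_pair j hj_symm ι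
  -- the exponents of the half-twist
  set p : (K →+* ℂ) → ℂ := fun ι => 1 / 2 - s₁ ι + N ι with hp
  -- key identity: `2 (p ι + p ῑ) = 2 - (e ι + e ῑ)` (uses (iii) through `j` and the flattening)
  have key : ∀ ι, (2 : ℂ) * (p ι + p (conjugate ι)) = 2 - (e ι + e (conjugate ι)) := by
    intro ι
    have h3 := hj ι
    have h4 := hNpair ι
    simp only [hp, he]
    linear_combination (-1 : ℂ) * h3 + 2 * h4
  -- (I) for `p`: hypothesis (ii)
  have hIp : ∀ ι : K →+* ℂ, ∃ n : ℤ, p ι - p (conjugate ι) = n := by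
    intro ι
    obtain ⟨m, hm⟩ := hii ι
    refine ⟨-m + (N ι - N (conjugate ι)), ?_⟩
    simp only [hp]
    push_cast
    linear_combination (-1 : ℂ) * hm
  -- (R) for `p`: (R) for `e`
  have hRp : ∃ r' : ℝ, ∀ ι : K →+* ℂ, (p ι + p (conjugate ι)).re = r' := by
    refine ⟨1 - r / 2, fun ι => ?_⟩
    have h := congrArg Complex.re (key ι)
    simp only [Complex.mul_re, Complex.sub_re, Complex.add_re] at h
    norm_num at h
    have hr := hR ι
    simp only [Complex.add_re] at hr
    rw [Complex.add_re]
    linarith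
  -- (T) for `p`: (T) for `e` with the imaginary weights multiplied by `-1/2`
  have hTp : ∃ M' : ℕ, 0 < M' ∧ ∀ α : (𝓞 K)ˣ,
      (∏ w : InfinitePlace K, ((‖w.embedding ((α : 𝓞 K) : K)‖ : ℂ) ^
        ((((p w.embedding + p (conjugate w.embedding)).im : ℝ) : ℂ) * Complex.I))) ^ M' = 1 := by
    refine ⟨2 * M, by omega, fun α => ?_⟩
    have him : ∀ w : InfinitePlace K, (p w.embedding + p (conjugate w.embedding)).im =
        -((e w.embedding + e (conjugate w.embedding)).im) / 2 := by
      intro w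
      have h := congrArg Complex.im (key w.embedding)
      simp only [Complex.mul_im, Complex.sub_im, Complex.add_im] at h
      norm_num at h
      simp only [Complex.add_im]
      linarith
    have hfac : ∀ w : InfinitePlace K,
        (((‖w.embedding ((α : 𝓞 K) : K)‖ : ℂ) ^
          ((((p w.embedding + p (conjugate w.embedding)).im : ℝ) : ℂ) * Complex.I))) ^ 2 =
        (((‖w.embedding ((α : 𝓞 K) : K)‖ : ℂ) ^
          ((((e w.embedding + e (conjugate w.embedding)).im : ℝ) : ℂ) * Complex.I)))⁻¹ := by
      intro w
      rw [← Complex.cpow_nat_mul, ← Complex.cpow_neg, him w]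
      congr 1
      push_cast; ring
    rw [pow_mul, ← Finset.prod_pow, Finset.prod_congr rfl fun w _ => hfac w, Finset.prod_inv_distrib,
      inv_pow, hT α, inv_one]
  -- assemble through the classification
  obtain ⟨χ, hχ⟩ := (hC K hK h1 p).mpr ⟨hIp, hRp, hTp⟩
  exact ⟨χ, p, hχ, fun ι => ⟨N ι, by simp only [hp]; ring⟩⟩

end Summit.Langlands.Langlands.Cruxes.HalfIntegralTwistCM.IdeaSketch3
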